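import Mathlib
import HarnessLib
import Summits.HubbardSuperconductivity.HubbardSuperconductivity.Theorems.KLProgrammeKLRegimeVolumeLimitV11HinstDoors

/-!
# Route `KLProgramme` — crux K3, VL child `KLRegimeVolumeLimitV17F2` (stmt-HubbardSuperconductivity-20440), skeleton «cauchy» v11: THE `hSup` DISCHARGER,
# part 2 — THE SUPPLIERS' HYPOTHESIS (with regime hooks) FROM FIVE NAMED ATOMS (seat hubbard-kl-k3c4-p1 g16; `--supports` 20440)

`stub_vl_towerData = stub_vl_towerData_of_suppliers_reg_pos hSup stub_vl_srcProfiles` (`…VolumeLimitV11TowerDataOfSuppliersReg`).  This file proves the body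
of `hSup` at constants `(G, P, Q, R, Q′)` with `R.WF2` (located «VL-R-WF2»: the suppliers' doors are stated under `R.WF2`) from FIVE atoms, each in the same
«post-tower instance» shape `∀ G P Q R (WF, R.WF2) → ∃ (volume-free constants) → ∃ c₇ → ∀ c ≤ c₇ → ∃ U₇ → ∀ μ U ≤ U₇ β (regime) K Lstar Mstar, TowerP … →
∃ (instance functions / laws) → ∃ L₂ M₂, ∀ L b M beyond them, (data at the flow frames K_V = klFlowFrameU V M β U μ (n_β+1), V ∈ {L, b·L})`:

* `Hcov` — the covariance bundles of `klStepCov V M β μ K_V j` (three placements), the sectional row and the transfer bundle at ONE rate `Λ`, ALL steps `j < n_β`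
  (p3's all-steps doors via `…V11HinstDoors.towerDoors_of_towerP` for `j ≥ 1` ⊕ the scale-0 lane's «SCALE-0-STEPCOV» for `j = 0`);
* `HE1` — E1: slice partition functions `≠ 0` and the alive read-out `klWtPinnedSumAt … j j m (𝒱_{j+1}[K_V]) ≤ S₀ j m` with the law
  `S₀ j (2m) ≤ C₀·klWtBudget P Q U (j+1) (2m)` (one volume; used at `V = L` and `V = b·L`);
* `Hmis` — k3c4-p2: the frame-MISMATCH rates (entry `sE`, rows `cR/ε`, columns `cC/ε` of `klStepCov (bL) K_{bL} j − klStepCov (bL) K_L j`; rows/columns `δ` of the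
  transfer mismatch), capped by `1`, tending to `0`;
* `Hbase` — the UNSCALED base-transfer bundle of `…TowerBase` (`towerBase_transferData_of_atoms`' seven conjuncts) with its scalars;
* `Hgrid` — `Nonempty (TowerGridDataD …)` with its scalars, four `θ < 1` inequalities and rates (k3c4-p2's kit incl. `Te`).

Inside: `k₀ := k₁`, `a₀ := a₁`, `kf := 3` (`κf := 3κ`, `gramPath_of_scaleCovData_same`), caps `cR₀ = cC₀ = δb₀ := 1`, `cW₀ := w₁`, `r₀ := 8e²·4·(w₁+2)`, `εb := 1`,
E1's law moved to `Qp := {Q with CE := Q.CE + 1}` (so `0 < CE`; `klWtBudget_mono_CE`), `B₂ := 8(Q.CE+1)D`, `B₃ := 8Q′.CE·D`, `W` = the (H3) product, `Λ_j := Λ_tel :=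
min Λ_{n_β+1} (ρ·4^{−(n_β+1)})`, `r j := j`, token #24 from the producer's `A ≥ 0` at both volumes, then `exists_towerDataTS_of_readouts` (p637313).

* **`hSupRegBody_of_atoms`** — the body of `hSup` (thresholded form) at `(G, P, Q, R, Q′)`, `R.WF2` (the composition with the producer text and the stub's
  threading is the sibling `…V11TowerDataOfAtoms.stub_vl_towerData_WF2_of_atoms`).

Proofs only; no definition.  Honest framing: plumbing of named hypotheses into a landed constructor; nothing here asserts any atom, stub, K3, VL or superconductivity.
[cite: BenfattoGiulianiMastropietro2006, §2.7-§2.9 and §3]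
-/

noncomputable section

namespace Summit.HubbardSuperconductivity.HubbardSuperconductivity.Theorems.TwoVolumeSource

set_option linter.dupNamespace false -- summit = problem name (single-conjunct summit), D-0017

open Finset Filter Topology Literature.MathematicalPhysics.QuantumLattice GrassmannAlgebra Literature.Probability.LatticeModels
  Literature.Probability.LatticeModels.BattleFederbush
open Summit.HubbardSuperconductivity.HubbardSuperconductivity.Theorems.KLRegimeSplit
open Summit.HubbardSuperconductivity.HubbardSuperconductivity.Theorems.KLProgrammeLegKernels
open Summit.HubbardSuperconductivity.HubbardSuperconductivity.Theorems.TwoPointAssembly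
open Summit.HubbardSuperconductivity.HubbardSuperconductivity.Theorems.EngineV8
open Summit.HubbardSuperconductivity.HubbardSuperconductivity.Theorems.TwoVolumeDefect
open Summit.HubbardSuperconductivity.HubbardSuperconductivity.Theorems.TorusFourierL2

/-! ## §1 Small laws -/

/-- `klWtBudget` is monotone in `Q.CE` (all factors nonnegative). [folklore] -/
theorem klWtBudget_mono_CE (P : SplitConsts) {Q Q₁ : EngConsts} (hCE : 0 ≤ Q.CE) (hle : Q.CE ≤ Q₁.CE) (hK : 0 ≤ P.Klam) (U : ℝ) (j m : ℕ) :
    klWtBudget P Q U j m ≤ klWtBudget P Q₁ U j m := by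
  unfold klWtBudget
  have hε := epsCoupling_nonneg' hK U j
  gcongr

/-- The telescoped rate `Λ_tel := min Λ_{n+1} (ρ·4^{−(n+1)})` is positive, below `Λ_{n+1}` and satisfies `Λ_tel·4^{n+1} ≤ ρ`. [folklore] -/
theorem rate_tel_laws {ρ : ℝ} (hρ : 0 < ρ) (n : ℕ) :
    0 < min (klScale klE0 (n + 1)) (ρ * ((4 : ℝ) ^ (n + 1))⁻¹) ∧ min (klScale klE0 (n + 1)) (ρ * ((4 : ℝ) ^ (n + 1))⁻¹) ≤ klScale klE0 (n + 1) ∧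
      min (klScale klE0 (n + 1)) (ρ * ((4 : ℝ) ^ (n + 1))⁻¹) * (4 : ℝ) ^ (n + 1) ≤ ρ := by
  have h4 : (0 : ℝ) < (4 : ℝ) ^ (n + 1) := by positivity
  refine ⟨lt_min (klth_klScale_pos _) (by positivity), min_le_left _ _, ?_⟩
  calc min (klScale klE0 (n + 1)) (ρ * ((4 : ℝ) ^ (n + 1))⁻¹) * (4 : ℝ) ^ (n + 1) ≤ ρ * ((4 : ℝ) ^ (n + 1))⁻¹ * (4 : ℝ) ^ (n + 1) :=
        mul_le_mul_of_nonneg_right (min_le_right _ _) h4.le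
    _ = ρ := by rw [mul_assoc, inv_mul_cancel₀ h4.ne', mul_one]

/-! ## §2 The suppliers' hypothesis from the five atoms -/

set_option maxHeartbeats 6400000 in -- one very large application with ~120 arguments and an eventual block of nine conjuncts
/-- **THE BODY OF `hSup` (thresholded form of `…V11TowerDataOfSuppliersReg`) AT `(G, P, Q, R, Q′)`, `R.WF2`, FROM THE FIVE ATOMS** (see the module docstring).
[folklore: composition; cite: BenfattoGiulianiMastropietro2006, §2.7-§2.9 and §3] -/
theorem hSupRegBody_of_atoms
    (Hcov : ∀ (G : GeoConsts) (P : SplitConsts) (Q : EngConsts) (R : RenConsts), G.WF → P.WF → Q.WF → R.WF2 →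
      ∃ k₁ a₁ s₁ e₁ w₁ ρ : ℝ, 0 < k₁ ∧ 0 < a₁ ∧ 0 ≤ s₁ ∧ 0 ≤ e₁ ∧ 1 ≤ w₁ ∧ 0 < ρ ∧
        ∃ c₇ : ℝ, 0 < c₇ ∧ ∀ c : ℝ, 0 < c → c ≤ c₇ → ∃ U₇ : ℝ, 0 < U₇ ∧
          ∀ μ ∈ klWindowC, ∀ U : ℝ, 0 < U → U ≤ U₇ → ∀ β : ℝ, klBetaMin ≤ β → β ≤ Real.exp (c / U ^ 2) →
            ∀ (K : TrigPolyC4v) (Lstar : ℕ) (Mstar : ℕ → ℕ), TowerP klPredsV17F2 G P Q R β U μ K Lstar Mstar →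
            ∀ Λ : ℝ, 0 ≤ Λ → Λ ≤ klScale klE0 (nScales β + 1) → Λ * (4 : ℝ) ^ (nScales β + 1) ≤ ρ →
            ∃ L₂ : ℕ, ∃ M₂ : ℕ → ℕ → ℕ, ∀ (L b M : ℕ) [NeZero L] [NeZero (b * L)] [NeZero M], L₂ ≤ L → M₂ L b ≤ M →
              (∀ j, j < nScales β → ScaleCovData (klStepCov L M β μ (klFlowFrameU L M β U μ (nScales β + 1)) j) Λ (Real.sqrt (k₁ ^ 2 * ((8 : ℝ) ^ j)⁻¹))
                (a₁ * (4 : ℝ) ^ j / imagTimeWeight β M) s₁) ∧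
              (∀ j, j < nScales β → ScaleCovData (klStepCov (b * L) M β μ (klFlowFrameU (b * L) M β U μ (nScales β + 1)) j) Λ (Real.sqrt (k₁ ^ 2 * ((8 : ℝ) ^ j)⁻¹))
                (a₁ * (4 : ℝ) ^ j / imagTimeWeight β M) s₁) ∧
              (∀ j, j < nScales β → ScaleCovData (klStepCov (b * L) M β μ (klFlowFrameU L M β U μ (nScales β + 1)) j) Λ (Real.sqrt (k₁ ^ 2 * ((8 : ℝ) ^ j)⁻¹))
                (a₁ * (4 : ℝ) ^ j / imagTimeWeight β M) s₁) ∧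
              (∀ j, j < nScales β → ScaleCovSecData (klStepCov (b * L) M β μ (klFlowFrameU L M β U μ (nScales β + 1)) j) Λ e₁) ∧
              (∀ j, j ≤ nScales β → TransferWtData (klTowerTransfer (b * L) M β μ (klFlowFrameU L M β U μ (nScales β + 1)) j)
                (klBlockEquivD L b M j) (klBlockEquivD L b M (j - 1)) Λ w₁))
    (HE1 : ∀ (G : GeoConsts) (P : SplitConsts) (Q : EngConsts) (R : RenConsts), G.WF → P.WF → Q.WF → R.WF2 →
      ∃ C₀ : ℝ, 0 ≤ C₀ ∧
        ∃ c₇ : ℝ, 0 < c₇ ∧ ∀ c : ℝ, 0 < c → c ≤ c₇ → ∃ U₇ : ℝ, 0 < U₇ ∧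
          ∀ μ ∈ klWindowC, ∀ U : ℝ, 0 < U → U ≤ U₇ → ∀ β : ℝ, klBetaMin ≤ β → β ≤ Real.exp (c / U ^ 2) →
            ∀ (K : TrigPolyC4v) (Lstar : ℕ) (Mstar : ℕ → ℕ), TowerP klPredsV17F2 G P Q R β U μ K Lstar Mstar →
            ∃ S₀ : ℕ → ℕ → ℝ, (∀ j m, 0 ≤ S₀ j m) ∧ (∀ j, j ≤ nScales β → ∀ m, 1 ≤ m → S₀ j (2 * m) ≤ C₀ * klWtBudget P Q U (j + 1) (2 * m)) ∧
            ∃ L₂ : ℕ, ∃ M₂ : ℕ → ℕ, ∀ (L M : ℕ) [NeZero L] [NeZero M], L₂ ≤ L → M₂ L ≤ M →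
              (∀ k, k ≤ nScales β → hubbardEffPartitionFnCT L M β U μ 0 (klFlowFrameU L M β U μ (nScales β + 1)) (klScale klE0 (k + 1)) ≠ 0) ∧
              (∀ j, j ≤ nScales β → ∀ (m : ℕ) (q : Fin m) (w : SpaceTimeIdx L M × SectorLeg (sectorCount j)),
                klWtPinnedSumAt L M β μ (klFlowFrameU L M β U μ (nScales β + 1)) j j m (klEffectiveAction L M β U μ (klFlowFrameU L M β U μ (nScales β + 1)) klE0 (j + 1)) q w ≤ S₀ j m))
    (Hmis : ∀ (G : GeoConsts) (P : SplitConsts) (Q : EngConsts) (R : RenConsts), G.WF → P.WF → Q.WF → R.WF2 →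
        ∃ c₇ : ℝ, 0 < c₇ ∧ ∀ c : ℝ, 0 < c → c ≤ c₇ → ∃ U₇ : ℝ, 0 < U₇ ∧
          ∀ μ ∈ klWindowC, ∀ U : ℝ, 0 < U → U ≤ U₇ → ∀ β : ℝ, klBetaMin ≤ β → β ≤ Real.exp (c / U ^ 2) →
            ∀ (K : TrigPolyC4v) (Lstar : ℕ) (Mstar : ℕ → ℕ), TowerP klPredsV17F2 G P Q R β U μ K Lstar Mstar →
            ∃ (sE cR cC δ : ℕ → ℕ → ℝ),
              (∀ j L, 0 ≤ sE j L ∧ 0 ≤ cR j L ∧ 0 ≤ cC j L ∧ 0 ≤ δ j L ∧ cR j L ≤ 1 ∧ cC j L ≤ 1 ∧ δ j L ≤ 1) ∧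
              (∀ j, Tendsto (sE j) atTop (𝓝 0) ∧ Tendsto (cR j) atTop (𝓝 0) ∧ Tendsto (cC j) atTop (𝓝 0) ∧ Tendsto (δ j) atTop (𝓝 0)) ∧
            ∃ L₂ : ℕ, ∃ M₂ : ℕ → ℕ → ℕ, ∀ (L b M : ℕ) [NeZero L] [NeZero (b * L)] [NeZero M], L₂ ≤ L → M₂ L b ≤ M →
              (∀ j, j < nScales β → ∀ x y, ‖(klStepCov (b * L) M β μ (klFlowFrameU (b * L) M β U μ (nScales β + 1)) j - klStepCov (b * L) M β μ (klFlowFrameU L M β U μ (nScales β + 1)) j) x y‖ ≤ sE j L) ∧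
              (∀ j, j < nScales β → ∀ x, ∑ y, ‖(klStepCov (b * L) M β μ (klFlowFrameU (b * L) M β U μ (nScales β + 1)) j - klStepCov (b * L) M β μ (klFlowFrameU L M β U μ (nScales β + 1)) j) x y‖ ≤
                cR j L / imagTimeWeight β M) ∧
              (∀ j, j < nScales β → ∀ y, ∑ x, ‖(klStepCov (b * L) M β μ (klFlowFrameU (b * L) M β U μ (nScales β + 1)) j - klStepCov (b * L) M β μ (klFlowFrameU L M β U μ (nScales β + 1)) j) x y‖ ≤
                cC j L / imagTimeWeight β M) ∧
              (∀ j, j ≤ nScales β → ∀ x, ∑ y, ‖klTowerTransfer (b * L) M β μ (klFlowFrameU (b * L) M β U μ (nScales β + 1)) j x y - klTowerTransfer (b * L) M β μ (klFlowFrameU L M β U μ (nScales β + 1)) j x y‖ ≤ δ j L) ∧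
              (∀ j, j ≤ nScales β → ∀ y, ∑ x, ‖klTowerTransfer (b * L) M β μ (klFlowFrameU (b * L) M β U μ (nScales β + 1)) j x y - klTowerTransfer (b * L) M β μ (klFlowFrameU L M β U μ (nScales β + 1)) j x y‖ ≤ δ j L))
    (Hbase : ∀ (G : GeoConsts) (P : SplitConsts) (Q : EngConsts) (R : RenConsts), G.WF → P.WF → Q.WF → R.WF2 →
        ∃ c₇ : ℝ, 0 < c₇ ∧ ∀ c : ℝ, 0 < c → c ≤ c₇ → ∃ U₇ : ℝ, 0 < U₇ ∧
          ∀ μ ∈ klWindowC, ∀ U : ℝ, 0 < U → U ≤ U₇ → ∀ β : ℝ, klBetaMin ≤ β → β ≤ Real.exp (c / U ^ 2) →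
            ∀ (K : TrigPolyC4v) (Lstar : ℕ) (Mstar : ℕ → ℕ), TowerP klPredsV17F2 G P Q R β U μ K Lstar Mstar →
            ∃ (ΛgT cgW Λg δgb : ℝ) (NG : ℕ → ℝ) (δg : ℕ → ℝ), 0 < ΛgT ∧ 0 ≤ cgW ∧ 0 < Λg ∧ (∀ k, 0 ≤ NG k) ∧ (∀ L, 0 ≤ δg L ∧ δg L ≤ δgb) ∧
              Tendsto δg atTop (𝓝 0) ∧
            ∃ L₂ : ℕ, ∃ M₂ : ℕ → ℕ → ℕ, ∀ (L b M : ℕ) [NeZero L] [NeZero (b * L)] [NeZero M], L₂ ≤ L → M₂ L b ≤ M →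
              (∀ x : SrcLabel (b * L) M 0, ∑ y, ‖klBaseTransfer (b * L) M β μ (klFlowFrameU L M β U μ (nScales β + 1)) x y‖ * (1 + ΛgT * (Torus.tnorm (x.1.1.2 - y.1.1.1.2) : ℝ)) ≤ cgW) ∧
              (∀ y : GridLeg (GridPoint (b * L) (klGridN M)) × Fin 2, ∑ x, ‖klBaseTransfer (b * L) M β μ (klFlowFrameU L M β U μ (nScales β + 1)) x y‖ * (1 + ΛgT * (Torus.tnorm (x.1.1.2 - y.1.1.1.2) : ℝ)) ≤ cgW) ∧
              (∀ (δ' β' β₁ : Fin 2 → Fin b) (xbar : SrcLabel L M 0) (y : GridLeg (GridPoint L (klGridN M)) × Fin 2),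
                ‖klBaseTransfer (b * L) M β μ (klFlowFrameU L M β U μ (nScales β + 1)) ((klBlockEquivD L b M 0).symm (β' + δ', xbar)) ((klGridBlockEquivD L b M).symm (β₁ + δ', y))‖ =
                  ‖klBaseTransfer (b * L) M β μ (klFlowFrameU L M β U μ (nScales β + 1)) ((klBlockEquivD L b M 0).symm (β', xbar)) ((klGridBlockEquivD L b M).symm (β₁, y))‖) ∧
              (∀ x, ∑ y, ‖klBaseTransfer (b * L) M β μ (klFlowFrameU (b * L) M β U μ (nScales β + 1)) x y - klBaseTransfer (b * L) M β μ (klFlowFrameU L M β U μ (nScales β + 1)) x y‖ ≤ δg L) ∧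
              (∀ y, ∑ x, ‖klBaseTransfer (b * L) M β μ (klFlowFrameU (b * L) M β U μ (nScales β + 1)) x y - klBaseTransfer (b * L) M β μ (klFlowFrameU L M β U μ (nScales β + 1)) x y‖ ≤ δg L) ∧
              (∀ (k : ℕ) (p : Fin k) (y : GridLeg (GridPoint L (klGridN M))),
                ∑ Y ∈ univ.filter (fun Y : Fin k → GridLeg (GridPoint L (klGridN M)) => Y p = y),
                  ‖kernel ℂ (klGridAction L M β U μ (klFlowFrameU L M β U μ (nScales β + 1))) k Y‖ *
                    (1 + labelDiam (fun Y₁ Y₂ : GridLeg (GridPoint L (klGridN M)) => Λg * (Torus.tnorm (Y₁.1.1.2 - Y₂.1.1.2) : ℝ)) (univ.image Y)) ≤ imagTimeWeight β M * NG k) ∧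
              (∀ (k : ℕ) (p : Fin k) (y : GridLeg (GridPoint (b * L) (klGridN M))),
                ∑ Y ∈ univ.filter (fun Y : Fin k → GridLeg (GridPoint (b * L) (klGridN M)) => Y p = y),
                  ‖kernel ℂ (klGridAction (b * L) M β U μ (klFlowFrameU (b * L) M β U μ (nScales β + 1))) k Y‖ *
                    (1 + labelDiam (fun Y₁ Y₂ : GridLeg (GridPoint (b * L) (klGridN M)) => Λg * (Torus.tnorm (Y₁.1.1.2 - Y₂.1.1.2) : ℝ)) (univ.image Y)) ≤ imagTimeWeight β M * NG k))
    (Hgrid : ∀ (G : GeoConsts) (P : SplitConsts) (Q : EngConsts) (R : RenConsts), G.WF → P.WF → Q.WF → R.WF2 →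
        ∃ c₇ : ℝ, 0 < c₇ ∧ ∀ c : ℝ, 0 < c → c ≤ c₇ → ∃ U₇ : ℝ, 0 < U₇ ∧
          ∀ μ ∈ klWindowC, ∀ U : ℝ, 0 < U → U ≤ U₇ → ∀ β : ℝ, klBetaMin ≤ β → β ≤ Real.exp (c / U ^ 2) →
            ∀ (K : TrigPolyC4v) (Lstar : ℕ) (Mstar : ℕ → ℕ), TowerP klPredsV17F2 G P Q R β U μ K Lstar Mstar →
            ∃ (κE aC cb κg κg' ρS ρg' ρg₂ ρgf aw al al' mo mo' s s' Θ νW νf νg₂ νD : ℝ) (sgE cc eE tT Te : ℕ → ℝ) (D₀ : ℕ),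
              (0 < κE ∧ 0 < aC ∧ 0 < κg ∧ 0 < κg' ∧ 0 < ρS ∧ 0 < ρg' ∧ 0 < ρg₂ ∧ 0 < ρgf ∧ 0 < aw ∧ 0 < al' + al ∧ 0 ≤ mo ∧ 0 ≤ mo' ∧ 0 ≤ s ∧ 0 ≤ s' ∧
                0 ≤ Θ ∧ 0 ≤ νW ∧ 0 ≤ νf ∧ 0 ≤ νg₂) ∧
              (Real.exp 1 * (aC + cb) * νW / κE ^ 2 < 1 ∧ Real.exp 1 * aw * Θ / κg' ^ 2 < 1 ∧
                Real.exp 1 * (al' + al + (mo' + mo)) * νf / (κg' + κg) ^ 2 < 1 ∧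
                Real.exp 1 * (al' + al + (mo' + mo)) * νg₂ / (κg' + κg + (κg' + κg + (κg' + κg))) ^ 2 < 1) ∧
              (∀ L, 0 ≤ sgE L ∧ 0 ≤ cc L ∧ 2 * cc L ≤ cb ∧ 0 < tT L ∧ 0 ≤ Te L) ∧
              (Tendsto sgE atTop (𝓝 0) ∧ Tendsto cc atTop (𝓝 0) ∧ Tendsto eE atTop (𝓝 0) ∧ Tendsto tT atTop (𝓝 0) ∧ Tendsto Te atTop (𝓝 0)) ∧
            ∃ L₂ : ℕ, ∃ M₂ : ℕ → ℕ → ℕ, ∀ (L b M : ℕ) [NeZero L] [NeZero (b * L)] [NeZero M], L₂ ≤ L → M₂ L b ≤ M →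
              Nonempty (TowerGridDataD L b M β U μ (klFlowFrameU L M β U μ (nScales β + 1)) (klFlowFrameU (b * L) M β U μ (nScales β + 1)) (imagTimeWeight β M) κE aC κg κg' ρS ρg' ρg₂ ρgf aw al al' mo mo' s s' Θ νW νf νg₂ νD
                (sgE L) (cc L) (eE L) (tT L) (Te L) (Nat.sqrt (L / (4 * nScales β + 7))) ((L / (4 * nScales β + 7)) - Nat.sqrt (L / (4 * nScales β + 7))) D₀))
    (G : GeoConsts) (P : SplitConsts) (Q : EngConsts) (R : RenConsts) (Q' : EngConsts) (hG : G.WF) (hP : P.WF) (hQ : Q.WF) (hR2 : R.WF2)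
    (hQ'CE : 0 ≤ Q'.CE) :
    ∃ (k₀ B₂ B₃ W : ℝ), 0 < k₀ ∧ 0 ≤ B₂ ∧ 0 ≤ B₃ ∧ 0 ≤ W ∧
      ∃ c₆ : ℝ, 0 < c₆ ∧ ∀ c : ℝ, 0 < c → c ≤ c₆ → ∃ U₆ : ℝ, 0 < U₆ ∧
        ∀ μ ∈ klWindowC, ∀ U : ℝ, 0 < U → U ≤ U₆ → ∀ β : ℝ, klBetaMin ≤ β → β ≤ Real.exp (c / U ^ 2) →
          ∀ K : TrigPolyC4v, klPredsV17F2.frameOK R U (nScales β) μ K →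
            ∀ (Lstar : ℕ) (Mstar : ℕ → ℕ), TowerP klPredsV17F2 G P Q R β U μ K Lstar Mstar →
              (∀ j, j ≤ nScales β → 0 < epsCoupling P U (j + 1) ∧ epsCoupling P U (j + 1) ≤ 1 ∧ B₂ * epsCoupling P U (j + 1) ≤ 1 ∧
                B₃ * epsCoupling P U (j + 1) ≤ 1 ∧ epsCoupling P U (j + 1) * W ≤ k₀ ^ 2) →
              ∀ (A : ℕ → ℕ → ℝ) (L₁ : ℕ) (M₁ : ℕ → ℕ), (∀ j s, 0 ≤ A j s) →
                (∀ (L M : ℕ) [NeZero L] [NeZero M], L₁ ≤ L → M₁ L ≤ M → ∀ j : ℕ, j + 1 ≤ nScales β + 1 →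
                  SourceProfilesAtLev L M (klSrcBudget P Q' U A (j + 1)) β U μ (klFlowFrameU L M β U μ (nScales β + 1)) j j (j + 1)) →
                ∃ t : ℝ, 0 < t ∧ t ≤ 1 ∧ Nonempty (TowerDataTS β U μ t) := by
  classical
  -- the atoms' volume-free constants and thresholds
  obtain ⟨k₁, a₁, s₁, e₁, w₁, ρ, hk₁, ha₁, hs₁, he₁, hw₁, hρ, c₁, hc₁, hcov⟩ := Hcov G P Q R hG hP hQ hR2
  obtain ⟨C₀, hC₀, c₂, hc₂, he1⟩ := HE1 G P Q R hG hP hQ hR2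
  obtain ⟨c₃, hc₃, hmis⟩ := Hmis G P Q R hG hP hQ hR2
  obtain ⟨c₄, hc₄, hbase⟩ := Hbase G P Q R hG hP hQ hR2
  obtain ⟨c₅, hc₅, hgrid⟩ := Hgrid G P Q R hG hP hQ hR2
  have hKl : 0 ≤ P.Klam := le_trans zero_le_one hP.1
  have hQCE : 0 ≤ Q.CE := hQ.1
  -- the engine constant with `0 < CE`
  set Qp : EngConsts := { Q with CE := Q.CE + 1 } with hQp
  have hQpCE : Qp.CE = Q.CE + 1 := rfl
  have hCEp : 0 < Qp.CE := by rw [hQpCE]; linarith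
  -- the sizes
  set r₀ : ℝ := 8 * Real.exp 2 * ((3 : ℝ) + 1) * (w₁ + 1 + 1) with hr₀
  have hr₀0 : 0 ≤ r₀ := by positivity
  set D : ℝ := 2 * Real.exp 2 ^ 2 * (1 + r₀) ^ 2 * k₁ ^ 2 with hD
  have hD0 : 0 ≤ D := by positivity
  refine ⟨k₁, 8 * Qp.CE * D, 8 * Q'.CE * D,
    256 * Real.exp 1 ^ 2 * (a₁ + 1 + 1 + 1) * (42 * w₁ + 4 * 1 + 8 * Real.exp 1) *
      (Qp.CE * D / 4 * (C₀ * (1 + 8 * Qp.CE * D) + 1 + 1 * Q'.CE * (1 + 8 * Q'.CE * D) / 4)),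
    hk₁, by positivity, by positivity, ?_, min c₁ (min c₂ (min c₃ (min c₄ c₅))),
    lt_min hc₁ (lt_min hc₂ (lt_min hc₃ (lt_min hc₄ hc₅))), fun c hc0 hcc => ?_⟩
  · have hw0 : 0 ≤ w₁ := zero_le_one.trans hw₁
    have : 0 ≤ Qp.CE := hCEp.le
    positivity
  have hcc₁ : c ≤ c₁ := hcc.trans (min_le_left _ _)
  have hcc₂ : c ≤ c₂ := hcc.trans ((min_le_right _ _).trans (min_le_left _ _))
  have hcc₃ : c ≤ c₃ := hcc.trans ((min_le_right _ _).trans ((min_le_right _ _).trans (min_le_left _ _)))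
  have hcc₄ : c ≤ c₄ := hcc.trans ((min_le_right _ _).trans ((min_le_right _ _).trans ((min_le_right _ _).trans (min_le_left _ _))))
  have hcc₅ : c ≤ c₅ := hcc.trans ((min_le_right _ _).trans ((min_le_right _ _).trans ((min_le_right _ _).trans (min_le_right _ _))))
  obtain ⟨U₁, hU₁, hcov1⟩ := hcov c hc0 hcc₁
  obtain ⟨U₂, hU₂, he11⟩ := he1 c hc0 hcc₂
  obtain ⟨U₃, hU₃, hmis1⟩ := hmis c hc0 hcc₃
  obtain ⟨U₄, hU₄, hbase1⟩ := hbase c hc0 hcc₄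
  obtain ⟨U₅, hU₅, hgrid1⟩ := hgrid c hc0 hcc₅
  refine ⟨min U₁ (min U₂ (min U₃ (min U₄ U₅))), lt_min hU₁ (lt_min hU₂ (lt_min hU₃ (lt_min hU₄ hU₅))), ?_⟩
  intro μ hμ U hU0 hUU β hβmin hβmax K hK Lstar Mstar hT heps A L₁ M₁ hA htok
  have hUU₁ : U ≤ U₁ := hUU.trans (min_le_left _ _)
  have hUU₂ : U ≤ U₂ := hUU.trans ((min_le_right _ _).trans (min_le_left _ _))
  have hUU₃ : U ≤ U₃ := hUU.trans ((min_le_right _ _).trans ((min_le_right _ _).trans (min_le_left _ _)))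
  have hUU₄ : U ≤ U₄ := hUU.trans ((min_le_right _ _).trans ((min_le_right _ _).trans ((min_le_right _ _).trans (min_le_left _ _))))
  have hUU₅ : U ≤ U₅ := hUU.trans ((min_le_right _ _).trans ((min_le_right _ _).trans ((min_le_right _ _).trans (min_le_right _ _))))
  have hβ : 0 < β := KLRegimeSplit.pos_of_klBetaMin_le hβmin
  have he0 : (0 : ℝ) < klE0 := by norm_num [klE0]
  -- the rate `Λ_tel`
  obtain ⟨hΛ0, hΛle, hΛρ⟩ := rate_tel_laws hρ (nScales β)
  set Λ : ℝ := min (klScale klE0 (nScales β + 1)) (ρ * ((4 : ℝ) ^ (nScales β + 1))⁻¹) with hΛdef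
  -- the instance data of the five atoms
  obtain ⟨L₂c, M₂c, hcovI⟩ := hcov1 μ hμ U hU0 hUU₁ β hβmin hβmax K Lstar Mstar hT Λ hΛ0.le hΛle hΛρ
  obtain ⟨S₀, hS₀0, hS₀law, L₂e, M₂e, he1I⟩ := he11 μ hμ U hU0 hUU₂ β hβmin hβmax K Lstar Mstar hT
  obtain ⟨sE, cR, cC, δ, hmisS, hmis0, L₂m, M₂m, hmisI⟩ := hmis1 μ hμ U hU0 hUU₃ β hβmin hβmax K Lstar Mstar hT
  obtain ⟨ΛgT, cgW, Λg, δgb, NG, δg, hgΛT, hcgW, hΛg, hNG0, hgδ, hgδ0, L₂b, M₂b, hbaseI⟩ := hbase1 μ hμ U hU0 hUU₄ β hβmin hβmax K Lstar Mstar hT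
  obtain ⟨κE, aC, cb, κg, κg', ρS, ρg', ρg₂, ρgf, aw, al, al', mo, mo', s, s', Θ, νW, νf, νg₂, νD, sgE, cc, eE, tT, Te, D₀,
    ⟨hκE, haC, hgκ, hgκ', hρS, hgρ', hgρ₂, hgρf, haw, haa, hm0, hm0', hs0, hs'0, hΘ0, hνW0, hνf0, hν₂0⟩, ⟨hθS, hθΘ, hθf, hθ₂⟩, hrate,
    ⟨hsE0, hcc0, heE0, htT0, hTe0⟩, L₂g, M₂g, hgridI⟩ := hgrid1 μ hμ U hU0 hUU₅ β hβmin hβmax K Lstar Mstar hT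
  -- the Matsubara threshold of the package
  set Mth : ℕ → ℕ → ℕ := fun L b => max 1 (max (M₂c L b) (max (M₂e L) (max (M₂e (b * L)) (max (M₂m L b) (max (M₂b L b) (max (M₂g L b)
    (max (M₁ L) (M₁ (b * L))))))))) with hMth
  have hMth1 : ∀ L b M, Mth L b ≤ M → 1 ≤ M := fun L b M h => (le_max_left _ _).trans h
  have hMthc : ∀ L b M, Mth L b ≤ M → M₂c L b ≤ M := fun L b M h => ((le_max_left _ _).trans (le_max_right _ _)).trans h
  have hMthe : ∀ L b M, Mth L b ≤ M → M₂e L ≤ M := fun L b M h =>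
    ((le_max_left _ _).trans ((le_max_right _ _).trans (le_max_right _ _))).trans h
  have hMthe' : ∀ L b M, Mth L b ≤ M → M₂e (b * L) ≤ M := fun L b M h =>
    ((le_max_left _ _).trans ((le_max_right _ _).trans ((le_max_right _ _).trans (le_max_right _ _)))).trans h
  have hMthm : ∀ L b M, Mth L b ≤ M → M₂m L b ≤ M := fun L b M h =>
    ((le_max_left _ _).trans ((le_max_right _ _).trans ((le_max_right _ _).trans ((le_max_right _ _).trans (le_max_right _ _))))).trans h
  have hMthb : ∀ L b M, Mth L b ≤ M → M₂b L b ≤ M := fun L b M h =>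
    ((le_max_left _ _).trans ((le_max_right _ _).trans ((le_max_right _ _).trans ((le_max_right _ _).trans ((le_max_right _ _).trans
      (le_max_right _ _)))))).trans h
  have hMthg : ∀ L b M, Mth L b ≤ M → M₂g L b ≤ M := fun L b M h =>
    ((le_max_left _ _).trans ((le_max_right _ _).trans ((le_max_right _ _).trans ((le_max_right _ _).trans ((le_max_right _ _).trans
      ((le_max_right _ _).trans (le_max_right _ _))))))).trans h
  have hMth₁ : ∀ L b M, Mth L b ≤ M → M₁ L ≤ M := fun L b M h =>
    ((le_max_left _ _).trans ((le_max_right _ _).trans ((le_max_right _ _).trans ((le_max_right _ _).trans ((le_max_right _ _).trans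
      ((le_max_right _ _).trans ((le_max_right _ _).trans (le_max_right _ _)))))))).trans h
  have hMth₁' : ∀ L b M, Mth L b ≤ M → M₁ (b * L) ≤ M := fun L b M h =>
    ((le_max_right _ _).trans ((le_max_right _ _).trans ((le_max_right _ _).trans ((le_max_right _ _).trans ((le_max_right _ _).trans
      ((le_max_right _ _).trans ((le_max_right _ _).trans (le_max_right _ _)))))))).trans h
  have hMthpos : ∀ L b M, Mth L b ≤ M → 0 < imagTimeWeight β M := fun L b M h => by
    have hM : (0 : ℝ) < M := by exact_mod_cast hMth1 L b M h
    show 0 < β / (2 * M)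
    positivity
  -- constants' laws
  have hκ2 : ∀ j : ℕ, Real.sqrt (k₁ ^ 2 * ((8 : ℝ) ^ j)⁻¹) ^ 2 = k₁ ^ 2 * ((8 : ℝ) ^ j)⁻¹ := fun j => Real.sq_sqrt (by positivity)
  have hκpos : ∀ j : ℕ, 0 < Real.sqrt (k₁ ^ 2 * ((8 : ℝ) ^ j)⁻¹) := fun j => Real.sqrt_pos.2 (by positivity)
  have hS₀law' : ∀ j, j ≤ nScales β → ∀ m, 1 ≤ m → S₀ j (2 * m) ≤ C₀ * klWtBudget P Qp U (j + 1) (2 * m) := fun j hj m hm =>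
    (hS₀law j hj m hm).trans (mul_le_mul_of_nonneg_left (klWtBudget_mono_CE P hQCE (by rw [hQpCE]; linarith) hKl U (j + 1) (2 * m)) hC₀)
  -- the eventual threshold in `L` and the three eventual blocks
  set L₀ : ℕ := max L₂c (max L₂e (max L₂m (max L₂b (max L₂g L₁)))) with hL₀
  have hinst : ∀ᶠ L in atTop, ∀ (b M : ℕ) [NeZero L] [NeZero (b * L)] [NeZero M], Mth L b ≤ M →
      (∀ k, k ≤ nScales β → hubbardEffPartitionFnCT L M β U μ 0 (klFlowFrameU L M β U μ (nScales β + 1)) (klScale klE0 (k + 1)) ≠ 0) ∧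
      (∀ k, k ≤ nScales β → hubbardEffPartitionFnCT (b * L) M β U μ 0 (klFlowFrameU (b * L) M β U μ (nScales β + 1)) (klScale klE0 (k + 1)) ≠ 0) ∧
      (∀ j, j < nScales β → ScaleCovData (klStepCov L M β μ (klFlowFrameU L M β U μ (nScales β + 1)) j) ((fun _ : ℕ => Λ) j)
        ((fun j : ℕ => Real.sqrt (k₁ ^ 2 * ((8 : ℝ) ^ j)⁻¹)) j) ((fun j : ℕ => a₁ * (4 : ℝ) ^ j) j / imagTimeWeight β M) ((fun _ : ℕ => s₁) j)) ∧
      (∀ j, j < nScales β →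
        ScaleCovData (klStepCov (b * L) M β μ (klFlowFrameU (b * L) M β U μ (nScales β + 1)) j) ((fun _ : ℕ => Λ) j)
          ((fun j : ℕ => Real.sqrt (k₁ ^ 2 * ((8 : ℝ) ^ j)⁻¹)) j) ((fun j : ℕ => a₁ * (4 : ℝ) ^ j) j / imagTimeWeight β M) ((fun _ : ℕ => s₁) j)) ∧
      (∀ j, j ≤ nScales β → ∀ (m : ℕ) (q : Fin m) (w : SpaceTimeIdx L M × SectorLeg (sectorCount j)),
        klWtPinnedSumAt L M β μ (klFlowFrameU L M β U μ (nScales β + 1)) j ((fun j : ℕ => j) j) m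
          (klEffectiveAction L M β U μ (klFlowFrameU L M β U μ (nScales β + 1)) klE0 (j + 1)) q w ≤ S₀ j m) ∧
      (∀ j, j ≤ nScales β → ∀ (m : ℕ) (q : Fin m) (w : SpaceTimeIdx (b * L) M × SectorLeg (sectorCount j)),
        klWtPinnedSumAt (b * L) M β μ (klFlowFrameU (b * L) M β U μ (nScales β + 1)) j ((fun j : ℕ => j) j) m
          (klEffectiveAction (b * L) M β U μ (klFlowFrameU (b * L) M β U μ (nScales β + 1)) klE0 (j + 1)) q w ≤ S₀ j m) ∧
      (∀ j, j ≤ nScales β → SourceProfilesAtLev L M (klSrcBudget P Q' U A (j + 1)) β U μ (klFlowFrameU L M β U μ (nScales β + 1)) j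
        ((fun j : ℕ => j) j) (j + 1)) ∧
      (∀ j, j ≤ nScales β →
        SourceProfilesAtLev (b * L) M (klSrcBudget P Q' U A (j + 1)) β U μ (klFlowFrameU (b * L) M β U μ (nScales β + 1)) j ((fun j : ℕ => j) j) (j + 1)) ∧
      TowerCrossData L b M β μ (klFlowFrameU L M β U μ (nScales β + 1)) (klFlowFrameU (b * L) M β U μ (nScales β + 1)) (nScales β) (imagTimeWeight β M)
        (fun _ => Λ) (fun j => Real.sqrt (k₁ ^ 2 * ((8 : ℝ) ^ j)⁻¹)) (fun j => a₁ * (4 : ℝ) ^ j) (fun _ => s₁) (fun _ => e₁) (fun _ => Λ) (fun _ => w₁)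
        (fun j => 3 * Real.sqrt (k₁ ^ 2 * ((8 : ℝ) ^ j)⁻¹)) (fun j => sE j L) (fun j => cR j L) (fun j => cC j L) (fun j => δ j L) := by
    refine Filter.eventually_atTop.2 ⟨L₀, fun L hL b M _ _ _ hM => ?_⟩
    have hLc : L₂c ≤ L := by omega
    have hLe : L₂e ≤ L := by omega
    have hLm : L₂m ≤ L := by omega
    have hL₁ : L₁ ≤ L := by omega
    have hb1 : 1 ≤ b := Nat.pos_of_ne_zero fun hb => NeZero.ne (b * L) (by rw [hb, Nat.zero_mul])
    have hLbL : L ≤ b * L := Nat.le_mul_of_pos_left L hb1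
    obtain ⟨hc1, hc2, hc3, hsec, htr⟩ := hcovI L b M hLc (hMthc L b M hM)
    obtain ⟨hZ, hread⟩ := he1I L M hLe (hMthe L b M hM)
    obtain ⟨hZ', hread'⟩ := he1I (b * L) M (hLe.trans hLbL) (hMthe' L b M hM)
    obtain ⟨hent, hrow, hcol, htrow, htcol⟩ := hmisI L b M hLm (hMthm L b M hM)
    exact ⟨hZ, hZ', hc1, hc2, hread, hread', fun j hj => htok L M hL₁ (hMth₁ L b M hM) j (by omega),
      fun j hj => htok (b * L) M (hL₁.trans hLbL) (hMth₁' L b M hM) j (by omega),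
      ⟨hc3, hsec, htr, fun j hj => gramPath_of_scaleCovData_same (hc3 j hj) (hc2 j hj), hent, hrow, hcol, htrow, htcol⟩⟩
  have hdataT' := Filter.eventually_atTop.2 ⟨L₀, fun L hL b M (_ : NeZero L) (_ : NeZero (b * L)) (_ : NeZero M) (hM : Mth L b ≤ M) =>
    hbaseI L b M (by omega) (hMthb L b M hM)⟩
  have hgdata' := Filter.eventually_atTop.2 ⟨L₀, fun L hL b M (_ : NeZero L) (_ : NeZero (b * L)) (_ : NeZero M) (hM : Mth L b ≤ M) =>
    hgridI L b M (by omega) (hMthg L b M hM)⟩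
  exact exists_towerDataTS_of_readouts β U μ hβ P Qp Q' hCEp hQ'CE hKl A hA Mth hMthpos
    (fun _ => Λ) (fun _ => Λ) (fun j => Real.sqrt (k₁ ^ 2 * ((8 : ℝ) ^ j)⁻¹)) (fun j => 3 * Real.sqrt (k₁ ^ 2 * ((8 : ℝ) ^ j)⁻¹))
    (fun j => a₁ * (4 : ℝ) ^ j) (fun _ => s₁) (fun _ => e₁) (fun _ => w₁) (fun _ => 1) (fun _ => 1) (fun _ => 1) sE cR cC δ (fun j => j)
    k₁ a₁ 1 1 3 w₁ 1 r₀ C₀ 1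
    (fun _ => hΛ0) (fun _ => le_rfl) (fun _ => le_rfl) (fun j hj => hΛle.trans (klScale_le_klScale he0.le (by omega)))
    hk₁ hκpos hκ2 (fun j => by linarith [hκpos j]) (fun j => le_rfl) (by norm_num) (fun j => by positivity) (fun j => le_rfl)
    (fun _ => hs₁) (fun _ => he₁) (fun _ => hw₁) (fun _ => le_rfl) (fun _ => zero_le_one) (fun _ => le_rfl) (fun _ => zero_le_one) (fun _ => le_rfl)
    (fun _ => zero_le_one) (fun _ => le_rfl) hr₀0 (by rw [hr₀]) hC₀
    S₀ hS₀0 hS₀law'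
    (fun j hj => (heps j hj).1) (fun j hj => (heps j hj).2.1) (fun j hj => (heps j hj).2.2.1) (fun j hj => (heps j hj).2.2.2.1)
    (fun j hj => by have h := (heps j (le_of_lt hj)).2.2.2.2; linarith [h])
    (fun j L => hmisS j L) hmis0 hinst
    hgΛT hcgW hΛg NG hNG0 δg hgδ hgδ0 hdataT' hκE haC hgκ hgκ' hρS hgρ' hgρ₂ hgρf haw haa hm0 hm0' hs0 hs'0 hΘ0 hνW0 hνf0 hν₂0 hθS hθΘ hθf hθ₂
    sgE cc eE tT Te D₀ hrate hsE0 hcc0 heE0 htT0 hTe0 hgdata'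


end Summit.HubbardSuperconductivity.HubbardSuperconductivity.Theorems.TwoVolumeSource

end
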